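import Summits.Ventures.PercRepro.RankLevelSetPerElemChainTriple
import Summits.Ventures.PercRepro.RankLevelSetPerElemFiveGirth

/-! # RankLevelSetPerElemFiveSeries — (★★) AT LEVEL `5` ON EVERY MATROID WITHOUT A SERIES TRIPLE, AND THE CLASS
THEOREMS (night-1 g37; dossier §49; on `RankLevelSetPerElemChainTriple` and `RankLevelSetPerElemFiveGirth`)

A SERIES TRIPLE of `M` is a set of three elements any two of which form a cocircuit — three pairwise parallel
elements of the dual (**`NoSeriesTriple`**; matroids whose cocircuits all have `≥ 3` elements qualify,
`noSeriesTriple_of_cocircuits`, and the deletion of a coloop keeps the property,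
`noSeriesTriple_delete_of_isColoop`). On such a matroid the refined chain of `RankLevelSetPerElemChainTriple`
closes every circuit class at level `5` (every circuit of an element in no parallel pair has `≥ 3 = 5 − 2`
elements), so **`perElemAt_five_of_no_triple`**: (★★) at level `5` at every element of every finite matroid with
`≥ 12` elements and no series triple — the reductions (loops, parallel pairs, coloops) are those of
`RankLevelSetPerElemFour` one level up, a parallel pair sending level `5` to level `4` of a minor
(`perElemAt_four`). Hence **`mono_step_five_of_no_triple`** and the class theorems (★★) / Mono on every matroid
without a series triple with `≤ 13` elements or of rank `≤ 7`. Together with `RankLevelSetPerElemFiveGirth`, the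
triangle obstruction of §48.12 at level `5` is reduced to matroids having BOTH a triangle through `y` AND a
series triple disjoint from it. Every declaration has a docstring; imports: the cell's own modules and Mathlib
only. Axioms: standard. -/

namespace PercRepro

open Set Matroid

variable {α : Type}

/-! ## Series triples -/

variable (M : Matroid α) [M.Finite]

omit [M.Finite] in
/-- **`NoSeriesTriple M`**: no three distinct elements of `M` are pairwise parallel in the dual `M✶` — no
two elements `q, r` are both in the dual closure of a nonloop `p` of `M✶` (i.e. `M` has no three elements any
two of which form a cocircuit). -/
def NoSeriesTriple : Prop :=
  ∀ p q r, p ≠ q → p ≠ r → q ≠ r → M✶.IsNonloop p → q ∈ M✶.closure {p} → r ∈ M✶.closure {p} → False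

omit [M.Finite] in
/-- **A matroid whose cocircuits all have `≥ 3` elements has no series triple**: two distinct nonloops `p, q` of
`M✶` with `q ∈ cl✶ {p}` give a cocircuit inside `{p, q}`. -/
theorem noSeriesTriple_of_cocircuits (hc : ∀ C, M.IsCocircuit C → 3 ≤ C.ncard) : NoSeriesTriple M := by
  intro p q r hpq hpr hqr hp hq hr
  have hqp : q ∉ ({p} : Set α) := by simpa using hpq.symm
  obtain ⟨C, hCsub, hC, hqC⟩ := Matroid.exists_isCircuit_of_mem_closure hq hqp
  have h3 := hc C hC
  have hCle : C.ncard ≤ ({q, p} : Set α).ncard := Set.ncard_le_ncard (by simpa using hCsub) (Set.toFinite _)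
  have h2 : ({q, p} : Set α).ncard ≤ 2 := by
    have := Set.ncard_insert_le q ({p} : Set α)
    rw [Set.ncard_singleton] at this
    exact this
  omega

omit [M.Finite] in
/-- **Deleting a coloop keeps `NoSeriesTriple`**: `(M ＼ x)✶ = M✶ ／ x = M✶ ＼ x` for the loop `x` of `M✶`, and the
dual closures only shrink. -/
theorem noSeriesTriple_delete_of_isColoop (hnt : NoSeriesTriple M) {x : α} (hx : M.IsColoop x) :
    NoSeriesTriple (M.delete {x}) := by
  intro p q r hpq hpr hqr hp hq hr
  have hxl : ({x} : Set α) ⊆ M✶.loops := by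
    rw [Set.singleton_subset_iff]
    exact (Matroid.dual_isLoop_iff_isColoop).mpr hx
  have hd : (M.delete {x})✶ = M✶.delete {x} := by
    rw [Matroid.dual_delete, Matroid.contract_eq_delete_of_subset_loops hxl]
  rw [hd] at hp hq hr
  have hp' : M✶.IsNonloop p := (Matroid.delete_isNonloop_iff.mp hp).1
  have hcl : (M✶.delete {x}).closure {p} ⊆ M✶.closure {p} := by
    rw [Matroid.delete_closure_eq]
    exact Set.sdiff_subset.trans (M✶.closure_subset_closure Set.sdiff_subset)
  exact hnt p q r hpq hpr hqr hp' (hcl hq) (hcl hr)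

/-! ## (★★) at level `5` -/

/-- **(★★) AT LEVEL `5` ON A COLOOP-FREE MATROID WITHOUT A SERIES TRIPLE, AT AN ELEMENT IN NO PARALLEL PAIR**
(`11 < #E`): every circuit of `y` has `≥ 3` elements, so every circuit class closes under the refined chain. -/
theorem perElemAt_five_of_coloopFree_of_no_triple (hcol : ∀ e, ¬ M.IsColoop e) (hnt : NoSeriesTriple M)
    {y : α} (hy : y ∈ M.E) (hnp : ∀ z, z ≠ y → y ∉ M.closure {z}) (hn : 2 * 5 + 1 < M.E.ncard) :
    {Z ∈ biIndep M 5 | y ∉ Z}.ncard ≤ {Q ∈ biIndep M 6 | y ∈ Q}.ncard := by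
  obtain ⟨z₀, hz₀⟩ : (M.E \ {y}).Nonempty := by
    rw [← Set.ncard_pos (M.ground_finite.subset Set.sdiff_subset), Set.ncard_sdiff_singleton_of_mem hy]
    omega
  have hz₀y : z₀ ≠ y := by simpa using hz₀.2
  refine perElemAt_of_perCircuit M hy 5 ?_
  intro Z₀ hZ₀
  have h3 := (fundCircuit_ncard_absorb M hy hnp hz₀y hZ₀).1
  refine perCircuit_le_of_no_triple M hcol hy (by norm_num) hn hZ₀ ?_ (by omega)
  intro p hp q hq r hr hpq hpr hqr hq' hr'
  have hpnl : M✶.IsNonloop p := by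
    refine Matroid.isNonloop_of_not_isLoop (by rw [Matroid.dual_ground]; exact hp.1) ?_
    rw [Matroid.dual_isLoop_iff_isColoop]
    exact hcol p
  exact hnt p q r hpq hpr hqr hpnl hq' hr'

/-- **(★★) AT LEVEL `5` FOR EVERY MATROID WITHOUT A SERIES TRIPLE ON `n` ELEMENTS** (the auxiliary form, by strong
induction on `n`): a loop kills every level, a parallel pair sends level `5` to level `4` of a minor
(`perElemAt_four`, `biIndepCount_four_le_five`), a coloop splits the level into the levels `4` and `5` of its
deletion, which has no series triple either. -/
theorem perElemAt_five_of_no_triple_aux :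
    ∀ n : ℕ, ∀ (M' : Matroid α) [M'.Finite], M'.E.ncard = n → NoSeriesTriple M' →
      ∀ y ∈ M'.E, 12 ≤ n → {Z ∈ biIndep M' 5 | y ∉ Z}.ncard ≤ {Q ∈ biIndep M' 6 | y ∈ Q}.ncard := by
  intro n
  induction n using Nat.strong_induction_on with
  | _ n ih =>
    intro M' _ hn hnt y hy h12
    -- a loop anywhere
    by_cases hloop : ∃ ℓ, M'.IsLoop ℓ
    · obtain ⟨ℓ, hℓ⟩ := hloop
      have : {Z ∈ biIndep M' 5 | y ∉ Z} = ∅ := by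
        rw [biIndep_eq_empty_of_isLoop M' hℓ 5]
        ext Z; simp
      rw [this, Set.ncard_empty]
      exact Nat.zero_le _
    simp only [not_exists] at hloop
    -- a parallel pair anywhere
    by_cases hpar : ∃ u v, ParallelPair M' u v
    · obtain ⟨u, v, huv⟩ := hpar
      haveI := contract_delete_finite M' u v
      have hcard := ncard_ground_contract_delete M' huv
      have hD : ∀ {u v : α} (h : ParallelPair M' u v),
          biIndepCount ((M'.contract {u}).delete {v}) 4 ≤ biIndepCount ((M'.contract {u}).delete {v}) 5 := by
        intro u v h
        haveI := contract_delete_finite M' u v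
        have hc := ncard_ground_contract_delete M' h
        exact biIndepCount_four_le_five ((M'.contract {u}).delete {v}) (by rw [hc]; omega)
      by_cases hyu : y = u
      · subst hyu
        exact perElem_succ_of_parallel_self M' huv 4 (hD huv)
      by_cases hyv : y = v
      · subst hyv
        exact perElem_succ_of_parallel_self M' huv.symm 4 (hD huv.symm)
      · have hyN : y ∈ ((M'.contract {u}).delete {v}).E := by
          rw [ground_contract_delete]
          exact ⟨hy, by simp only [Set.mem_insert_iff, Set.mem_singleton_iff, not_or]; exact ⟨hyu, hyv⟩⟩
        exact perElem_succ_of_parallel_other M' huv hyu hyv 4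
          (perElemAt_four ((M'.contract {u}).delete {v}) hyN (by rw [hcard]; omega))
    simp only [not_exists] at hpar
    -- a coloop anywhere
    by_cases hcol : ∃ x, M'.IsColoop x
    · obtain ⟨x, hx⟩ := hcol
      haveI := delete_finite' M' x
      have hcard : (M'.delete {x}).E.ncard = n - 1 := by
        rw [Matroid.delete_ground, Set.ncard_sdiff_singleton_of_mem hx.mem_ground, hn]
      have hnt' : NoSeriesTriple (M'.delete {x}) := noSeriesTriple_delete_of_isColoop M' hnt hx
      by_cases hyx : y = x
      · subst hyx
        exact (perElem_coloop_self M' hx 5).le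
      · have hyM : y ∈ (M'.delete {x}).E := by
          rw [Matroid.delete_ground]
          exact ⟨hy, by simpa using hyx⟩
        refine perElem_succ_of_coloop M' hx hyx 4 (perElemAt_four (M'.delete {x}) hyM (by omega)) ?_
        rcases Nat.lt_or_ge (n - 1) 12 with h11 | h12'
        · exact (perElem_middle_eq (M'.delete {x}) hyM 5 (by omega)).le
        · exact ih (n - 1) (by omega) (M'.delete {x}) hcard hnt' y hyM h12'
    simp only [not_exists] at hcol
    exact perElemAt_five_of_coloopFree_of_no_triple M' hcol hnt hy
      (fun _ hz => notMem_closure_singleton_of_no_partner M' hy (hloop y) (hpar y) hz) (by omega)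

/-- **(★★) AT LEVEL `5` FOR EVERY MATROID WITHOUT A SERIES TRIPLE AND EVERY ELEMENT** (`12 ≤ #E`):
`#{Z ∈ D_5 : y ∉ Z} ≤ #{Q ∈ D_6 : y ∈ Q}`. -/
theorem perElemAt_five_of_no_triple (hnt : NoSeriesTriple M) {y : α} (hy : y ∈ M.E) (hn : 12 ≤ M.E.ncard) :
    {Z ∈ biIndep M 5 | y ∉ Z}.ncard ≤ {Q ∈ biIndep M 6 | y ∈ Q}.ncard :=
  perElemAt_five_of_no_triple_aux M.E.ncard M rfl hnt y hy hn

/-- **(★★) AT LEVEL `5` FOR EVERY MATROID WHOSE COCIRCUITS HAVE `≥ 3` ELEMENTS** (`12 ≤ #E`). -/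
theorem perElemAt_five_of_cocircuits (hc : ∀ C, M.IsCocircuit C → 3 ≤ C.ncard) {y : α} (hy : y ∈ M.E)
    (hn : 12 ≤ M.E.ncard) : {Z ∈ biIndep M 5 | y ∉ Z}.ncard ≤ {Q ∈ biIndep M 6 | y ∈ Q}.ncard :=
  perElemAt_five_of_no_triple M (noSeriesTriple_of_cocircuits M hc) hy hn

/-- **MONO'S STEP `j = 5` FOR EVERY MATROID WITHOUT A SERIES TRIPLE**: `(#E − 5) · D_5 ≤ 6 · D_6` for `12 ≤ #E`. -/
theorem mono_step_five_of_no_triple (hnt : NoSeriesTriple M) (hn : 12 ≤ M.E.ncard) :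
    (M.E.ncard - 5) * biIndepCount M 5 ≤ 6 * biIndepCount M 6 :=
  mono_step_of_perElemAt M 5 (fun _ hy => perElemAt_five_of_no_triple M hnt hy hn)

/-! ## The class theorems -/

/-- **(★★) at every level `j ≤ 5` on a matroid without a series triple** (`2j + 1 < #E`). -/
theorem perElemAt_le_five_of_no_triple (hnt : NoSeriesTriple M) {y : α} (hy : y ∈ M.E) {j : ℕ}
    (hj : j ≤ 5) (hn : 2 * j + 1 < M.E.ncard) :
    {Z ∈ biIndep M j | y ∉ Z}.ncard ≤ {Q ∈ biIndep M (j + 1) | y ∈ Q}.ncard := by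
  rcases Nat.lt_or_ge j 5 with h4 | h5
  · exact perElemAt_le_four M hy (by omega) hn
  · have : j = 5 := by omega
    subst this
    exact perElemAt_five_of_no_triple M hnt hy (by omega)

/-- **(★★) holds on every matroid without a series triple with at most `13` elements** (only the levels `≤ 5`
occur). -/
theorem biIndepPerElem_of_ncard_le_thirteen_of_no_triple (hnt : NoSeriesTriple M) (hn : M.E.ncard ≤ 13) :
    BiIndepPerElem M :=
  fun _ hy j hj => perElemAt_le_five_of_no_triple M hnt hy (by omega) hj

/-- **Mono holds on every matroid without a series triple with at most `13` elements**. -/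
theorem biIndepMono_of_ncard_le_thirteen_of_no_triple (hnt : NoSeriesTriple M) (hn : M.E.ncard ≤ 13) :
    BiIndepMono M :=
  biIndepMono_of_perElem M (biIndepPerElem_of_ncard_le_thirteen_of_no_triple M hnt hn)

/-- **(★★) holds on every matroid without a series triple and of rank at most `7`**: at a level `j ≥ 6` with
`2j + 1 < #E` a bi-independent `j`-set would have an independent complement of `#E − j ≥ 8` elements. -/
theorem biIndepPerElem_of_eRank_le_seven_of_no_triple (hnt : NoSeriesTriple M) (hr : M.eRank ≤ 7) :
    BiIndepPerElem M := by
  intro y hy j hj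
  rcases Nat.lt_or_ge j 6 with h5 | h6
  · exact perElemAt_le_five_of_no_triple M hnt hy (by omega) hj
  · have hempty : biIndep M j = ∅ := by
      refine biIndep_eq_empty_of_eRank_lt M (lt_of_le_of_lt hr ?_)
      have h8 : (8 : ℕ) ≤ M.E.ncard - j := by omega
      calc (7 : ℕ∞) < ((8 : ℕ) : ℕ∞) := by norm_num
        _ ≤ ((M.E.ncard - j : ℕ) : ℕ∞) := by exact_mod_cast h8
    have hL : {Z ∈ biIndep M j | y ∉ Z} = ∅ := by
      rw [hempty]
      ext Z
      simp
    rw [hL, Set.ncard_empty]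
    exact Nat.zero_le _

/-- **Mono holds on every matroid without a series triple and of rank at most `7`**. -/
theorem biIndepMono_of_eRank_le_seven_of_no_triple (hnt : NoSeriesTriple M) (hr : M.eRank ≤ 7) :
    BiIndepMono M :=
  biIndepMono_of_perElem M (biIndepPerElem_of_eRank_le_seven_of_no_triple M hnt hr)

end PercRepro
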